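import Summits.CriticalPhenomena.PercolationContinuityZ3.Theorems.PercNearOneGluingNoHeavyLowerTailCILGlueBridge
import HarnessLib

/-!
# `NoHeavyLowerTail` (stmt-CriticalPhenomena-4575) — algebra of block closures of a reachability relation (two blocks, merging, roots)

Support file (prover `prim-hp-3`, hull-port line; `--supports stmt-CriticalPhenomena-4575`).  No definitions, no named facts, no sorries.
Lemmas (L2), (L3) of the refined plan for the overtaking bound (run/shared/lean/prim/prim-hp-3/PROOF-OVERTAKING-BOUND.md §7).  Pure logic about the
closure `R^B(a,b) :⟺ R(a,b) ∨ (a ~_R B ∧ B ~_R b)` of a relation through a finite block `B` (written out; no definitions):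

* `Hyperedge.reachClosure_transitive` — `R` transitive ⇒ `R^B` transitive;
* `Hyperedge.reachClosure_root_iff` — (L3) for `R` reflexive and transitive, `r ∈ T`, and the two-block relation `Q = (R^T)^S`:
  `(∃ t ∈ T, Q t z) ↔ Q r z` — the lightness of the block `T` is the lightness of any of its members;
* `Hyperedge.reachClosure_merge_iff` — (L2) for `R` reflexive, `r_T ∈ T`, `r_S ∈ S`: closing the two-block relation `(R^T)^S` through the pair
  `{r_T, r_S}` gives the one-block closure `R^{T ∪ S}` (pointwise) — gluing the representatives merges the blocks.
With `Hyperedge.real_update_one_reachFunctional` / `real_glueList_reachFunctional` these turn block lightnesses into honest `prodBernoulli`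
lightnesses of root vertices, and the merged block into one more weight-one pair.
-/

noncomputable section

namespace Summit.CriticalPhenomena.PercolationContinuityZ3.Theorems

open scoped Classical

variable {n : ℕ}

namespace Hyperedge

/-- The closure of a transitive relation through a block is transitive. [folklore] -/
theorem reachClosure_transitive (R : Fin n → Fin n → Prop) (htrans : ∀ a b c, R a b → R b c → R a c) (B : Finset (Fin n))
    (a b c : Fin n)
    (hab : R a b ∨ ((∃ t ∈ B, R a t) ∧ ∃ t ∈ B, R t b)) (hbc : R b c ∨ ((∃ t ∈ B, R b t) ∧ ∃ t ∈ B, R t c)) :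
    R a c ∨ ((∃ t ∈ B, R a t) ∧ ∃ t ∈ B, R t c) := by
  rcases hab with hab | ⟨⟨t₁, ht₁, h₁⟩, ⟨t₂, ht₂, h₂⟩⟩
  · rcases hbc with hbc | ⟨⟨t₃, ht₃, h₃⟩, ⟨t₄, ht₄, h₄⟩⟩
    · exact Or.inl (htrans _ _ _ hab hbc)
    · exact Or.inr ⟨⟨t₃, ht₃, htrans _ _ _ hab h₃⟩, ⟨t₄, ht₄, h₄⟩⟩
  · rcases hbc with hbc | ⟨_, ⟨t₄, ht₄, h₄⟩⟩
    · exact Or.inr ⟨⟨t₁, ht₁, h₁⟩, ⟨t₂, ht₂, htrans _ _ _ h₂ hbc⟩⟩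
    · exact Or.inr ⟨⟨t₁, ht₁, h₁⟩, ⟨t₄, ht₄, h₄⟩⟩

/-- **Block lightness = root lightness.**  For `R` reflexive and transitive, `r ∈ T`, and the two-block relation `Q = (R^T)^S`:
`(∃ t ∈ T, Q t z) ↔ Q r z`. [folklore] -/
theorem reachClosure_root_iff (R : Fin n → Fin n → Prop) (hrefl : ∀ a, R a a) (htrans : ∀ a b c, R a b → R b c → R a c)
    (T S : Finset (Fin n)) {r : Fin n} (hr : r ∈ T) (z : Fin n) :
    (∃ t ∈ T, ((R t z ∨ ((∃ c ∈ T, R t c) ∧ ∃ c' ∈ T, R c' z)) ∨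
        ((∃ s ∈ S, R t s ∨ ((∃ c ∈ T, R t c) ∧ ∃ c' ∈ T, R c' s)) ∧
          ∃ s' ∈ S, R s' z ∨ ((∃ c ∈ T, R s' c) ∧ ∃ c' ∈ T, R c' z)))) ↔
      ((R r z ∨ ((∃ c ∈ T, R r c) ∧ ∃ c' ∈ T, R c' z)) ∨
        ((∃ s ∈ S, R r s ∨ ((∃ c ∈ T, R r c) ∧ ∃ c' ∈ T, R c' s)) ∧
          ∃ s' ∈ S, R s' z ∨ ((∃ c ∈ T, R s' c) ∧ ∃ c' ∈ T, R c' z))) := by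
  -- `R₁ := R^T` is transitive, hence so is `Q = R₁^S`; and `Q r t` for every `t ∈ T`
  set R₁ : Fin n → Fin n → Prop := fun a b => R a b ∨ ((∃ c ∈ T, R a c) ∧ ∃ c' ∈ T, R c' b) with hR₁
  have h1trans : ∀ a b c, R₁ a b → R₁ b c → R₁ a c := fun a b c hab hbc => reachClosure_transitive R htrans T a b c hab hbc
  have hQtrans : ∀ a b c, (R₁ a b ∨ ((∃ s ∈ S, R₁ a s) ∧ ∃ s' ∈ S, R₁ s' b)) →
      (R₁ b c ∨ ((∃ s ∈ S, R₁ b s) ∧ ∃ s' ∈ S, R₁ s' c)) → (R₁ a c ∨ ((∃ s ∈ S, R₁ a s) ∧ ∃ s' ∈ S, R₁ s' c)) :=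
    fun a b c hab hbc => reachClosure_transitive R₁ h1trans S a b c hab hbc
  constructor
  · rintro ⟨t, ht, hQ⟩
    have hrt : R₁ r t := Or.inr ⟨⟨r, hr, hrefl r⟩, ⟨t, ht, hrefl t⟩⟩
    exact hQtrans r t z (Or.inl hrt) hQ
  · intro h
    exact ⟨r, hr, h⟩

/-- **Merging two blocks.**  For `R` reflexive, `r_T ∈ T`, `r_S ∈ S`: closing the two-block relation `Q = (R^T)^S` through the pair `{r_T, r_S}` is the
one-block closure through `T ∪ S`. [folklore] -/
theorem reachClosure_merge_iff (R : Fin n → Fin n → Prop) (hrefl : ∀ a, R a a) (T S : Finset (Fin n)) {rT rS : Fin n}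
    (hrT : rT ∈ T) (hrS : rS ∈ S) (a b : Fin n) :
    ((((R a b ∨ ((∃ c ∈ T, R a c) ∧ ∃ c' ∈ T, R c' b)) ∨
          ((∃ s ∈ S, R a s ∨ ((∃ c ∈ T, R a c) ∧ ∃ c' ∈ T, R c' s)) ∧
            ∃ s' ∈ S, R s' b ∨ ((∃ c ∈ T, R s' c) ∧ ∃ c' ∈ T, R c' b))) ∨
        ((∃ ρ ∈ ({rT, rS} : Finset (Fin n)),
            ((R a ρ ∨ ((∃ c ∈ T, R a c) ∧ ∃ c' ∈ T, R c' ρ)) ∨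
              ((∃ s ∈ S, R a s ∨ ((∃ c ∈ T, R a c) ∧ ∃ c' ∈ T, R c' s)) ∧
                ∃ s' ∈ S, R s' ρ ∨ ((∃ c ∈ T, R s' c) ∧ ∃ c' ∈ T, R c' ρ)))) ∧
          ∃ ρ ∈ ({rT, rS} : Finset (Fin n)),
            ((R ρ b ∨ ((∃ c ∈ T, R ρ c) ∧ ∃ c' ∈ T, R c' b)) ∨
              ((∃ s ∈ S, R ρ s ∨ ((∃ c ∈ T, R ρ c) ∧ ∃ c' ∈ T, R c' s)) ∧
                ∃ s' ∈ S, R s' b ∨ ((∃ c ∈ T, R s' c) ∧ ∃ c' ∈ T, R c' b))))) ↔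
      (R a b ∨ ((∃ t ∈ T ∪ S, R a t) ∧ ∃ t ∈ T ∪ S, R t b))) := by
  -- abbreviations: `toU a` = `a ~_R (T ∪ S)`, `fromU b` = `(T ∪ S) ~_R b`
  have hTU : ∀ t ∈ T, t ∈ T ∪ S := fun t ht => Finset.mem_union_left _ ht
  have hSU : ∀ s ∈ S, s ∈ T ∪ S := fun s hs => Finset.mem_union_right _ hs
  -- the two-block relation implies: `R a b`, or `a ~ U` and `U ~ b`
  have hQ : ∀ a b : Fin n, ((R a b ∨ ((∃ c ∈ T, R a c) ∧ ∃ c' ∈ T, R c' b)) ∨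
      ((∃ s ∈ S, R a s ∨ ((∃ c ∈ T, R a c) ∧ ∃ c' ∈ T, R c' s)) ∧
        ∃ s' ∈ S, R s' b ∨ ((∃ c ∈ T, R s' c) ∧ ∃ c' ∈ T, R c' b))) →
      (R a b ∨ ((∃ t ∈ T ∪ S, R a t) ∧ ∃ t ∈ T ∪ S, R t b)) := by
    intro a b h
    rcases h with (h | ⟨⟨c, hc, hac⟩, ⟨c', hc', hcb⟩⟩) | ⟨⟨s, hs, has⟩, ⟨s', hs', hsb⟩⟩
    · exact Or.inl h
    · exact Or.inr ⟨⟨c, hTU c hc, hac⟩, ⟨c', hTU c' hc', hcb⟩⟩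
    · right
      refine ⟨?_, ?_⟩
      · rcases has with h | ⟨⟨c, hc, hac⟩, _⟩
        · exact ⟨s, hSU s hs, h⟩
        · exact ⟨c, hTU c hc, hac⟩
      · rcases hsb with h | ⟨_, ⟨c', hc', hcb⟩⟩
        · exact ⟨s', hSU s' hs', h⟩
        · exact ⟨c', hTU c' hc', hcb⟩
  -- if the two-block relation holds from `a` to a member of `U`, then `a ~ U`
  have htoU : ∀ a ρ : Fin n, ρ ∈ T ∪ S → (R a ρ ∨ ((∃ t ∈ T ∪ S, R a t) ∧ ∃ t ∈ T ∪ S, R t ρ)) → ∃ t ∈ T ∪ S, R a t := by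
    intro a ρ hρ h
    rcases h with h | ⟨h, _⟩
    · exact ⟨ρ, hρ, h⟩
    · exact h
  have hfromU : ∀ ρ b : Fin n, ρ ∈ T ∪ S → (R ρ b ∨ ((∃ t ∈ T ∪ S, R ρ t) ∧ ∃ t ∈ T ∪ S, R t b)) → ∃ t ∈ T ∪ S, R t b := by
    intro ρ b hρ h
    rcases h with h | ⟨_, h⟩
    · exact ⟨ρ, hρ, h⟩
    · exact h
  have hρU : ∀ ρ ∈ ({rT, rS} : Finset (Fin n)), ρ ∈ T ∪ S := by
    intro ρ hρ
    simp only [Finset.mem_insert, Finset.mem_singleton] at hρ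
    rcases hρ with rfl | rfl
    · exact hTU _ hrT
    · exact hSU _ hrS
  constructor
  · rintro (h | ⟨⟨ρ, hρ, haρ⟩, ⟨ρ', hρ', hρb⟩⟩)
    · exact hQ a b h
    · exact Or.inr ⟨htoU a ρ (hρU ρ hρ) (hQ a ρ haρ), hfromU ρ' b (hρU ρ' hρ') (hQ ρ' b hρb)⟩
  · rintro (h | ⟨⟨t₁, ht₁, h₁⟩, ⟨t₂, ht₂, h₂⟩⟩)
    · exact Or.inl (Or.inl (Or.inl h))
    · right
      have hrTmem : rT ∈ ({rT, rS} : Finset (Fin n)) := Finset.mem_insert_self _ _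
      have hrSmem : rS ∈ ({rT, rS} : Finset (Fin n)) := Finset.mem_insert_of_mem (Finset.mem_singleton_self _)
      refine ⟨?_, ?_⟩
      · -- `a` reaches the representative of the block containing `t₁`
        rcases Finset.mem_union.1 ht₁ with ht₁T | ht₁S
        · exact ⟨rT, hrTmem, Or.inl (Or.inr ⟨⟨t₁, ht₁T, h₁⟩, ⟨rT, hrT, hrefl rT⟩⟩)⟩
        · exact ⟨rS, hrSmem, Or.inr ⟨⟨t₁, ht₁S, Or.inl h₁⟩, ⟨rS, hrS, Or.inl (hrefl rS)⟩⟩⟩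
      · rcases Finset.mem_union.1 ht₂ with ht₂T | ht₂S
        · exact ⟨rT, hrTmem, Or.inl (Or.inr ⟨⟨rT, hrT, hrefl rT⟩, ⟨t₂, ht₂T, h₂⟩⟩)⟩
        · exact ⟨rS, hrSmem, Or.inr ⟨⟨rS, hrS, Or.inl (hrefl rS)⟩, ⟨t₂, ht₂S, Or.inl h₂⟩⟩⟩

end Hyperedge

end Summit.CriticalPhenomena.PercolationContinuityZ3.Theorems
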